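import Mathlib.Combinatorics.SetFamily.HarrisKleitman
import Mathlib.Tactic.Linarith
import Summits.CriticalPhenomena.PercolationContinuityZ3.Theorems.PercNearOneGluingNoHeavyLowerTailSahiCTCForms
import HarnessLib

/-!
# `NoHeavyLowerTail` (crux stmt-CriticalPhenomena-4575), P3 lane: the HARRIS BLOCK of the c = 2 step certificates, profile-wise —
# `Π·GF(F ∩ G) − GF(F)·GF(G) ∈ ℕ[r]` for down-sets `F, G` ('Kleitman twice in links', memo g9 §7.3)

Support file (seat `prim-l12-p3`, gen 18; `--supports stmt-CriticalPhenomena-4575`).  Memo g9 §7.3: `Harris[F,G] = Π|F∩G| − |F||G|` is coefficientwise ≥ 0 for down-sets: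
"at a monomial `r^M` with doubled part `D` and support `N` the two counts are `|F'∩G'|` and `|F'∩(G')*|` in the Boolean interval `[D, N]` (F', G' the down-sets
induced there, * = complements), and Kleitman twice gives `|F'∩G'| ≥ |F'||G'|/2^g ≥ |F'∩G'*|`".  This file proves exactly that, with Mathlib's relative
Harris–Kleitman inequality `IsLowerSet.le_card_inter_finset'` (the anticorrelation half is derived from it inside the cube).
* `card_inter_compl_le_card_inter` : for down-sets `F', G'` of subsets of `s`: `#{T ∈ F' : s ∖ T ∈ G'} ≤ #(F' ∩ G')`;
* `coeff_harris` : for down-sets `F, G` and every profile `n`: `coeff n (GF(F)·GF(G)) ≤ coeff n (Π·GF(F ∩ G))`; `coeff_harris_sub_nonneg`.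
Nothing is asserted about the crux.
-/

namespace Summit.CriticalPhenomena.PercolationContinuityZ3.Theorems.SahiCTCForms

open Finset MvPolynomial SahiCTCGenFun SahiCTCWeightedLYM

variable {α : Type*} [DecidableEq α]

/-- **Kleitman twice**: for down-sets `F', G'` of subsets of `s`, the members of `F'` whose complement in `s` lies in `G'` are at most `#(F' ∩ G')`.
[folklore] -/
theorem card_inter_compl_le_card_inter {s : Finset α} {F' G' : Finset (Finset α)} (hF : IsLowerSet (F' : Set (Finset α)))
    (hG : IsLowerSet (G' : Set (Finset α))) (hFs : ∀ t ∈ F', t ⊆ s) (hGs : ∀ t ∈ G', t ⊆ s) :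
    #(F'.filter fun T => s \ T ∈ G') ≤ #(F' ∩ G') := by
  -- the family L' = {T ⊆ s : s \ T ∉ G'} is a down-set of subsets of s with 2^#s - #G' members
  obtain ⟨L', hL'⟩ : ∃ L' : Finset (Finset α), L' = s.powerset.filter (fun T => s \ T ∉ G') := ⟨_, rfl⟩
  have hLlow : IsLowerSet (L' : Set (Finset α)) := by
    intro T T' hT'T hT
    rw [Finset.mem_coe, hL', mem_filter, mem_powerset] at hT ⊢
    refine ⟨hT'T.trans hT.1, fun hin => hT.2 (hG ?_ hin)⟩
    exact sdiff_subset_sdiff Subset.rfl hT'T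
  have hLs : ∀ t ∈ L', t ⊆ s := fun t ht => mem_powerset.1 (mem_filter.1 (hL' ▸ ht)).1
  -- the complement-in-s map is a bijection between {T ⊆ s : s \ T ∈ G'} and G'
  have hU : #(s.powerset.filter fun T => s \ T ∈ G') = #G' := by
    refine card_bij (fun T _ => s \ T) (fun T hT => (mem_filter.1 hT).2) (fun T hT T' hT' h => ?_) (fun T hT => ?_)
    · have h1 : T ⊆ s := mem_powerset.1 (mem_filter.1 hT).1
      have h2 : T' ⊆ s := mem_powerset.1 (mem_filter.1 hT').1
      rw [← Finset.sdiff_sdiff_eq_self h1, h, Finset.sdiff_sdiff_eq_self h2]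
    · refine ⟨s \ T, mem_filter.2 ⟨mem_powerset.2 sdiff_subset, ?_⟩, Finset.sdiff_sdiff_eq_self (hGs T hT)⟩
      rw [Finset.sdiff_sdiff_eq_self (hGs T hT)]; exact hT
  have hsplit : #(s.powerset.filter fun T => s \ T ∈ G') + #L' = 2 ^ #s := by
    rw [hL', card_filter_add_card_filter_not, card_powerset]
  -- F' splits along the same predicate
  have hFsplit : #(F'.filter fun T => s \ T ∈ G') + #(F' ∩ L') = #F' := by
    have : F' ∩ L' = F'.filter (fun T => ¬ (s \ T ∈ G')) := by
      ext T; simp only [hL', mem_inter, mem_filter, mem_powerset]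
      constructor
      · rintro ⟨h1, _, h3⟩; exact ⟨h1, h3⟩
      · rintro ⟨h1, h3⟩; exact ⟨h1, hFs T h1, h3⟩
    rw [this, card_filter_add_card_filter_not]
  -- Kleitman for (F', G') and for (F', L')
  have k1 := hF.le_card_inter_finset' hG hFs hGs
  have k2 := hF.le_card_inter_finset' hLlow hFs hLs
  -- arithmetic: 2^s · #filt ≤ #F'·#G' ≤ 2^s · #(F' ∩ G')
  have hpos : 0 < 2 ^ #s := Nat.two_pow_pos _
  have step : 2 ^ #s * #(F'.filter fun T => s \ T ∈ G') ≤ #F' * #G' := by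
    have e1 : #L' = 2 ^ #s - #G' := by omega
    have e2 : #(F' ∩ L') = #F' - #(F'.filter fun T => s \ T ∈ G') := by omega
    have hGle : #G' ≤ 2 ^ #s := by omega
    have hfle : #(F'.filter fun T => s \ T ∈ G') ≤ #F' := by omega
    rw [e1, e2, Nat.mul_sub, Nat.mul_sub] at k2
    -- k2 : #F' * 2^s - #F' * #G' ≤ 2^s * #F' - 2^s * #filt
    have a1 : #F' * #G' ≤ #F' * 2 ^ #s := Nat.mul_le_mul_left _ hGle
    have a2 : 2 ^ #s * #(F'.filter fun T => s \ T ∈ G') ≤ 2 ^ #s * #F' := Nat.mul_le_mul_left _ hfle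
    have comm : #F' * 2 ^ #s = 2 ^ #s * #F' := Nat.mul_comm _ _
    omega
  exact Nat.le_of_mul_le_mul_left (step.trans k1) hpos

variable [Fintype α]

/-- **The Harris block, profile-wise** (memo g9 §7.3): for down-sets `F, G` every coefficient of `GF(F)·GF(G)` is at most the corresponding coefficient of
`Π·GF(F ∩ G)`. [this work] -/
theorem coeff_harris {F G : Finset (Finset α)} (hF : IsLowerSet (F : Set (Finset α))) (hG : IsLowerSet (G : Set (Finset α))) (n : α →₀ ℕ) :
    (gf F * gf G).coeff n ≤ (PiP * gf (F ∩ G)).coeff n := by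
  unfold PiP
  rw [coeff_gf_mul_gf, coeff_gf_mul_gf]
  by_cases hn : ∀ i, n i ≤ 2
  swap
  · rw [filter_prod_eq_empty _ _ n hn, filter_prod_eq_empty _ _ n hn]
  obtain ⟨D, hD⟩ : ∃ D : Finset α, D = dbl n := ⟨_, rfl⟩
  obtain ⟨N, hN⟩ : ∃ N : Finset α, N = n.support := ⟨_, rfl⟩
  obtain ⟨s, hs⟩ : ∃ s : Finset α, s = N \ D := ⟨_, rfl⟩
  obtain ⟨F', hF'⟩ : ∃ F' : Finset (Finset α), F' = s.powerset.filter (fun T => D ∪ T ∈ F) := ⟨_, rfl⟩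
  obtain ⟨G', hG'⟩ : ∃ G' : Finset (Finset α), G' = s.powerset.filter (fun T => D ∪ T ∈ G) := ⟨_, rfl⟩
  have hF'low : IsLowerSet (F' : Set (Finset α)) := by
    intro T T' hT'T hT
    rw [Finset.mem_coe, hF', mem_filter, mem_powerset] at hT ⊢
    exact ⟨hT'T.trans hT.1, hF (union_subset_union Subset.rfl hT'T) hT.2⟩
  have hG'low : IsLowerSet (G' : Set (Finset α)) := by
    intro T T' hT'T hT
    rw [Finset.mem_coe, hG', mem_filter, mem_powerset] at hT ⊢
    exact ⟨hT'T.trans hT.1, hG (union_subset_union Subset.rfl hT'T) hT.2⟩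
  have hF's : ∀ t ∈ F', t ⊆ s := fun t ht => mem_powerset.1 (mem_filter.1 (hF' ▸ ht)).1
  have hG's : ∀ t ∈ G', t ⊆ s := fun t ht => mem_powerset.1 (mem_filter.1 (hG' ▸ ht)).1
  have key := card_inter_compl_le_card_inter hF'low hG'low hF's hG's
  have hDN : ∀ {P S : Finset α}, ind P + ind S = n → P ∩ S = D ∧ P ∪ S = N := fun h => by
    rw [hD, hN]; exact ((ind_add_ind_eq_iff _ _ _).1 h).2
  have hDsubN : D ⊆ N := by rw [hD, hN]; exact filter_subset _ _
  -- LHS: pairs (S, T) ∈ F × G with S ∩ T = D, S ∪ T = N  ↦  S \ D ∈ F' with s \ (S \ D) ∈ G'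
  have hL : #((F ×ˢ G).filter fun PS => ind PS.1 + ind PS.2 = n) ≤ #(F'.filter fun T => s \ T ∈ G') := by
    refine card_le_card_of_injOn (fun PS => PS.1 \ D) (fun PS hPS => ?_) (fun PS hPS QT hQT h => ?_)
    · obtain ⟨hmem, hsum⟩ := mem_filter.1 (Finset.mem_coe.1 hPS)
      obtain ⟨hSF, hTG⟩ := mem_product.1 hmem
      obtain ⟨hI, hU⟩ := hDN hsum
      have hDS : D ⊆ PS.1 := hI ▸ inter_subset_left
      have hSN : PS.1 ⊆ N := hU ▸ subset_union_left
      have hI' : PS.2 ∩ PS.1 = D := by rw [inter_comm]; exact hI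
      have hU' : PS.2 ∪ PS.1 = N := by rw [union_comm]; exact hU
      have hT : PS.2 = D ∪ (N \ PS.1) := fst_eq_of_inter_union hI' hU'
      rw [Finset.mem_coe, mem_filter, hF', mem_filter, mem_powerset, hG', mem_filter, mem_powerset]
      refine ⟨⟨by rw [hs]; exact sdiff_subset_sdiff hSN Subset.rfl, by rw [union_sdiff_of_subset hDS]; exact hSF⟩, sdiff_subset, ?_⟩
      have : s \ (PS.1 \ D) = N \ PS.1 := by
        ext x; simp only [hs, mem_sdiff]; constructor
        · rintro ⟨⟨hxN, hxD⟩, h⟩; exact ⟨hxN, fun hxS => h ⟨hxS, hxD⟩⟩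
        · rintro ⟨hxN, hxS⟩; exact ⟨⟨hxN, fun hxD => hxS (hDS hxD)⟩, fun h => hxS h.1⟩
      rw [this, ← hT]; exact hTG
    · obtain ⟨_, hsum⟩ := mem_filter.1 (Finset.mem_coe.1 hPS)
      obtain ⟨_, hsum'⟩ := mem_filter.1 (Finset.mem_coe.1 hQT)
      obtain ⟨hI, hU⟩ := hDN hsum
      obtain ⟨hI', hU'⟩ := hDN hsum'
      have hDS : D ⊆ PS.1 := hI ▸ inter_subset_left
      have hDS' : D ⊆ QT.1 := hI' ▸ inter_subset_left
      have h' : PS.1 \ D = QT.1 \ D := h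
      have h1 : PS.1 = QT.1 := by
        rw [← union_sdiff_of_subset hDS, ← union_sdiff_of_subset hDS', h']
      have e1 : PS.2 = D ∪ (N \ PS.1) := fst_eq_of_inter_union (by rw [inter_comm]; exact hI) (by rw [union_comm]; exact hU)
      have e2 : QT.2 = D ∪ (N \ QT.1) := fst_eq_of_inter_union (by rw [inter_comm]; exact hI') (by rw [union_comm]; exact hU')
      have h2 : PS.2 = QT.2 := by rw [e1, e2, h1]
      exact Prod.ext h1 h2
  -- RHS: S \ D ∈ F' ∩ G'  ↦  the pair (D ∪ (N \ (D ∪ T)), D ∪ T)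
  have hR : #(F' ∩ G') ≤ #((univ.powerset ×ˢ (F ∩ G)).filter fun PS => ind PS.1 + ind PS.2 = n) := by
    refine card_le_card_of_injOn (fun T => (D ∪ (N \ (D ∪ T)), D ∪ T)) (fun T hT => ?_) (fun T hT T' hT' h => ?_)
    · obtain ⟨hTF, hTG⟩ := mem_inter.1 (Finset.mem_coe.1 hT)
      rw [hF'] at hTF; rw [hG'] at hTG
      obtain ⟨hTs, hTF''⟩ := mem_filter.1 hTF
      have hTG'' := (mem_filter.1 hTG).2
      have hTs' : T ⊆ s := mem_powerset.1 hTs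
      have hTN : ∀ x, x ∈ T → x ∈ N := fun x hx => (mem_sdiff.1 ((hs ▸ hTs') hx)).1
      have hDN' : ∀ x, x ∈ D → x ∈ N := fun x hx => hDsubN hx
      rw [Finset.mem_coe, mem_filter, mem_product]
      refine ⟨⟨mem_powerset.2 (subset_univ _), mem_inter.2 ⟨hTF'', hTG''⟩⟩, ?_⟩
      rw [ind_add_ind_eq_iff, ← hD, ← hN]
      refine ⟨hn, ?_, ?_⟩
      · ext x; simp only [mem_inter, mem_union, mem_sdiff]; tauto
      · ext x; simp only [mem_union, mem_sdiff]
        constructor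
        · intro h; rcases h with (hx | ⟨hx, _⟩) | (hx | hx)
          · exact hDN' x hx
          · exact hx
          · exact hDN' x hx
          · exact hTN x hx
        · intro hx; by_cases h' : x ∈ D ∨ x ∈ T
          · exact Or.inr h'
          · exact Or.inl (Or.inr ⟨hx, h'⟩)
    · have hTs1 : T ⊆ s := mem_powerset.1 (mem_filter.1 (hF' ▸ (mem_inter.1 (Finset.mem_coe.1 hT)).1)).1
      have hTs2 : T' ⊆ s := mem_powerset.1 (mem_filter.1 (hF' ▸ (mem_inter.1 (Finset.mem_coe.1 hT')).1)).1
      have h2 : D ∪ T = D ∪ T' := (Prod.ext_iff.1 h).2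
      have hd1 : Disjoint D T := disjoint_left.2 fun x hxD hxT => (mem_sdiff.1 ((hs ▸ hTs1) hxT)).2 hxD
      have hd2 : Disjoint D T' := disjoint_left.2 fun x hxD hxT => (mem_sdiff.1 ((hs ▸ hTs2) hxT)).2 hxD
      rw [← union_sdiff_cancel_left hd1, h2, union_sdiff_cancel_left hd2]
  exact_mod_cast hL.trans (key.trans hR)

/-- `Π·GF(F ∩ G) − GF(F)·GF(G) ∈ ℕ[r]` for down-sets `F, G`. [this work] -/
theorem coeff_harris_sub_nonneg {F G : Finset (Finset α)} (hF : IsLowerSet (F : Set (Finset α))) (hG : IsLowerSet (G : Set (Finset α)))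
    (n : α →₀ ℕ) : 0 ≤ (PiP * gf (F ∩ G) - gf F * gf G).coeff n := by
  rw [coeff_sub, sub_nonneg]; exact_mod_cast coeff_harris hF hG n

end Summit.CriticalPhenomena.PercolationContinuityZ3.Theorems.SahiCTCForms
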